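import Literature.NumberTheory.Automorphic.Liu2021.AppendixC.AlbaneseFunctorial
import Literature.AlgebraicGeometry.Motives.AlgPointsSeparate
import HarnessLib

/-!
# Liu 2021, Def. 2.3 / §4.2: `Alb_u` is an EPIMORPHISM when `∇u` is — e.g. when `∇u` is surjective on geometric points

[Liu2021] = Yifeng Liu, *Fourier–Jacobi cycles and arithmetic relative trace formula*, Camb. J. Math. **9** (2021) 1–147 =
arXiv:2102.11518 (`FJcycle.tex` line numbers as in `AppendixC/Glue.lean`).  PROOF FILE (theorems only; no definition, no named fact,
no instance, no `sorry`) over the carriers `AppendixC.Nabla` / `AppendixC.Albanese` (Def. 2.1 (1), Def. 2.3) and the kernel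
functoriality `Nabla.map` / `Albanese.map` of `AppendixC/AlbaneseFunctorial.lean`, and over the §4.2 datum `Sec42Data` (fields
`nablaTr`, `Atr`, `α_Atr`).

Def. 2.3 (l. 1206–1208): «For a morphism `u : Y → X` of proper smooth schemes over `k`, we have the induced morphism
`Alb_u : Alb_Y → Alb_X` by the universal property, which satisfies `Alb_u ∘ α_Y = α_X ∘ ∇u`.»  §4.2 (l. 2064): «For `K' ⊆ K`, we
denote the transition morphism by `u^{K'}_K : X_{K'} → X_K`, which is a generically finite dominant morphism.»

* `Albanese.epi_map_of_nablaMap_cancel` — if `∇u : ∇Y → ∇X` cancels on the left against morphisms into abelian varieties then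
  `Alb_u` is an epimorphism of abelian varieties (uniqueness half of the corepresentability of `Alb_X` + the printed identity);
* `Albanese.epi_map_of_nablaMap_surjective_algPoints` — hence `Alb_u` is an epimorphism as soon as `∇u` is SURJECTIVE ON
  `Ω`-POINTS (`Ω ⊇ k` algebraically closed) and `∇X` is reduced and locally of finite type: geometric points of a reduced scheme
  separate morphisms into a separated one ([MumfordAV1970] §4; tree `SchemeOver.hom_ext_of_forall_algPoints`);
* `Sec42Data.epi_Atr_of_nablaTr_cancel`, `Sec42Data.epi_Atr_of_nablaTr_surjective_algPoints` — the same for the POSITED transition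
  data `∇u^{K'}_K` / `Alb_{u^{K'}_K}` of a §4.2 datum (fields `nablaTr` / `Atr`, identity `α_Atr`).

Use: with `AppendixC/RestOneLevelInvariantsHom.lean` (`Sec42Data.pullInjective_of_epi`) this reduces input (I) `PullInjective` of the
reduction of [Liu2021, Thm. 4.18 (1)] (`AppendixC/RestOneLevelInvariants.lean`) to «`∇u^{K'}_K` is surjective on complex points» — a
statement about the complex points of the tower.  HC_CM is NOT proved; nothing here discharges a binder by itself.
-/

set_option autoImplicit false

noncomputable section

open CategoryTheory AlgebraicGeometry NumberField

universe u

namespace Literature.NumberTheory.Automorphic.Liu2021.AppendixC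

open Literature.AlgebraicGeometry.Motives (SchemeOver AbelianVariety AlgPoints)

namespace Albanese

variable {k : Type u} [Field k] {X Y : SchemeOver k}

/-- **`Alb_u` is an epimorphism as soon as `∇u` cancels on the left against morphisms into abelian varieties**: if
`∇u ≫ g₁ = ∇u ≫ g₂ ⇒ g₁ = g₂` for all `g₁, g₂ : ∇X → B` (`B` an abelian variety), then `Alb_u : Alb_Y → Alb_X` is an epimorphism
of abelian varieties — by the uniqueness half of the corepresentability of `Alb_X` (Def. 2.3) and the printed identity
`α_Y ≫ Alb_u = ∇u ≫ α_X`. [cite: Liu2021, Def. 2.3, l. 1202–1208] -/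
theorem epi_map_of_nablaMap_cancel (aY : Albanese Y) (aX : Albanese X) (u : Y ⟶ X)
    (h : ∀ (B : AbelianVariety k) (g₁ g₂ : aX.nabla.N ⟶ B.X),
      aY.nabla.map aX.nabla u ≫ g₁ = aY.nabla.map aX.nabla u ≫ g₂ → g₁ = g₂) :
    Epi (aY.map aX u) := by
  refine ⟨fun {B} ψ₁ ψ₂ hψ => ?_⟩
  apply aX.hom_ext
  apply h B
  have e₁ : aY.α ≫ (aY.map aX u ≫ ψ₁).hom.hom.hom = aY.nabla.map aX.nabla u ≫ aX.α ≫ ψ₁.hom.hom.hom := by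
    have hc : (aY.map aX u ≫ ψ₁).hom.hom.hom = (aY.map aX u).hom.hom.hom ≫ ψ₁.hom.hom.hom := rfl
    rw [hc]
    exact aY.α_map_assoc aX u _
  have e₂ : aY.α ≫ (aY.map aX u ≫ ψ₂).hom.hom.hom = aY.nabla.map aX.nabla u ≫ aX.α ≫ ψ₂.hom.hom.hom := by
    have hc : (aY.map aX u ≫ ψ₂).hom.hom.hom = (aY.map aX u).hom.hom.hom ≫ ψ₂.hom.hom.hom := rfl
    rw [hc]
    exact aY.α_map_assoc aX u _
  rw [← e₁, ← e₂, hψ]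

/-- **`Alb_u` is an epimorphism as soon as `∇u : ∇Y → ∇X` is surjective on `Ω`-points** (`Ω ⊇ k` algebraically closed), for
`∇X` reduced and locally of finite type (e.g. `X` smooth): `Ω`-points of the reduced `∇X` separate morphisms into the
separated `B` (tree `SchemeOver.hom_ext_of_forall_algPoints`, [MumfordAV1970] §4), and every `Ω`-point of `∇X` lifts along `∇u`.
For Liu's tower (`u = u^{K'}_K : X_{K'} → X_K` «generically finite dominant», §4.2 l. 2064) this is the surjectivity of
`Alb_{u^{K'}_K}`. [cite: Liu2021, Def. 2.3 (l. 1202–1208) and §4.2 l. 2064–2072] -/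
theorem epi_map_of_nablaMap_surjective_algPoints (Ω : Type u) [Field Ω] [Algebra k Ω] [IsAlgClosed Ω]
    (aY : Albanese Y) (aX : Albanese X) (u : Y ⟶ X)
    [LocallyOfFiniteType aX.nabla.N.hom] [IsReduced aX.nabla.N.left]
    (hs : ∀ P : AlgPoints aX.nabla.N Ω, ∃ Q : AlgPoints aY.nabla.N Ω, Q ≫ aY.nabla.map aX.nabla u = P) :
    Epi (aY.map aX u) := by
  refine epi_map_of_nablaMap_cancel aY aX u fun B g₁ g₂ hg => ?_
  refine SchemeOver.hom_ext_of_forall_algPoints Ω fun P => ?_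
  obtain ⟨Q, rfl⟩ := hs P
  rw [Category.assoc, Category.assoc, hg]

end Albanese

/-! ## The same for the posited transition data of a §4.2 datum -/

namespace Sec42Data

variable {F E : Type} [Field F] [NumberField F] [IsTotallyReal F] [Field E] [NumberField E] [Algebra F E]
  [IsTotallyComplex E] [Algebra.IsQuadraticExtension F E]
variable {P5 : PropC5Data F E} {isotropicAt : ℕ → Prop} (C : Sec42Data P5 isotropicAt)

/-- **`Alb_{u^{K'}_K}` is an epimorphism as soon as `∇u^{K'}_K` cancels on the left against morphisms into abelian varieties**
(§4.2 datum: `Atr f` is the universal-property homomorphism attached to `nablaTr f ≫ α_K`, `Sec42Data.α_Atr`).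
[cite: Liu2021, Def. 2.3 (l. 1206–1208) and §4.2 l. 2064–2072] -/
theorem epi_Atr_of_nablaTr_cancel {K K' : C5.SmallLevel C.S.K₀} (f : K' ⟶ K)
    (h : ∀ (B : AbelianVariety E) (g₁ g₂ : (C.alb K).nabla.N ⟶ B.X),
      C.nablaTr f ≫ g₁ = C.nablaTr f ≫ g₂ → g₁ = g₂) :
    Epi (C.Atr f) := by
  refine ⟨fun {B} ψ₁ ψ₂ hψ => ?_⟩
  apply (C.alb K).hom_ext
  apply h B
  have e : ∀ ψ : C.A K ⟶ B, (C.alb K').α ≫ (C.Atr f ≫ ψ).hom.hom.hom = C.nablaTr f ≫ (C.alb K).α ≫ ψ.hom.hom.hom := by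
    intro ψ
    have hc : (C.Atr f ≫ ψ).hom.hom.hom = (C.Atr f).hom.hom.hom ≫ ψ.hom.hom.hom := rfl
    rw [hc, ← Category.assoc, C.α_Atr f, Category.assoc]
  rw [← e, ← e, hψ]

/-- **`Alb_{u^{K'}_K}` is an epimorphism as soon as `∇u^{K'}_K` is surjective on `Ω`-points** (`Ω ⊇ E` algebraically closed;
`∇X_K` reduced and locally of finite type, which holds for the smooth `X_K`).  With `Sec42Data.pullInjective_of_epi` this is input (I)
of the reduction of Thm. 4.18 (1). [cite: Liu2021, Def. 2.3 (l. 1206–1208) and §4.2 l. 2064–2072] -/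
theorem epi_Atr_of_nablaTr_surjective_algPoints (Ω : Type) [Field Ω] [Algebra E Ω] [IsAlgClosed Ω]
    {K K' : C5.SmallLevel C.S.K₀} (f : K' ⟶ K)
    [LocallyOfFiniteType (C.alb K).nabla.N.hom] [IsReduced (C.alb K).nabla.N.left]
    (hs : ∀ P : AlgPoints (C.alb K).nabla.N Ω, ∃ Q : AlgPoints (C.alb K').nabla.N Ω, Q ≫ C.nablaTr f = P) :
    Epi (C.Atr f) := by
  refine C.epi_Atr_of_nablaTr_cancel f fun B g₁ g₂ hg => ?_
  refine SchemeOver.hom_ext_of_forall_algPoints Ω fun P => ?_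
  obtain ⟨Q, rfl⟩ := hs P
  rw [Category.assoc, Category.assoc, hg]

end Sec42Data

end Literature.NumberTheory.Automorphic.Liu2021.AppendixC

end
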